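import Summits.CriticalPhenomena.SAWScalingLimit.Theorems.SAWDevelopingMapObservableToSLETypeLadderCarvedReductionSqueezeWindowFrame
import Summits.CriticalPhenomena.SAWScalingLimit.Theorems.SAWDefectDecoherenceObservableToSLERCarvedReductionSqueezeLegs
import HarnessLib

/-!
# The framed two-piece flat super-domain: legs in corridors below LOWERED windows, frames at the
# gates, Newman cutting, gate boxes (piece (T-A′ P3) of stub T-A′
# `stub_carvedReduction_squeezeGeometry_domains`)

Crux `SAWDevelopingMap.ObservableToSLE` (stmt-CriticalPhenomena-10472), line `six-class-type-ladder`,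
stub T-A′ `stub_carvedReduction_squeezeGeometry_domains`.  Landing target:
`Summits/CriticalPhenomena/SAWScalingLimit/Theorems/SAWDevelopingMapObservableToSLETypeLadderCarvedReductionSqueezeSuperFrame.lean`
(`--supports stmt-CriticalPhenomena-10472`; registered carrier `stub_carvedReduction_superFrame`).
Sequel of `…SqueezeWindowFrame` (`stub_carvedReduction_windowFrame`, `superDomain_box_subset_compl`);
uses the twin's `Squeeze.stub_carvedReduction_legsToCrosscut` (p135598) and
`Squeeze.stub_carvedReduction_superDomainOfCrosscuts` (p133663).

The continuum assembly of the OUTER two-piece flat super-domain `E^sup` of the pinned frame, from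
abstract corridor data (to be supplied by the corridor piece from the limit package): for each gate
`g i` a corridor `O i` (open, connected, inside `J`, missing the closed gate rectangle
`R i = [re g i ± ρ'] × [im g i - h, im g i]`, the closed gate ball `closedBall (g i) ρw` and the
closed LOWERED window `closedBall (g i - h i) ρ'`, containing the two docks hanging from the lowered
diameter ends) and an exit cross-cut `η i` of `J` inside `O i`; the two gates' data pairwise apart;
and a bulk link from `g 0 + (ρw/2) i` to `g 1 + (ρw/2) i` in `J` off both corridors and rectangles.
Then (`stub_carvedReduction_superFrame`): window cross-cuts `L i` through the FRAMES
(`legsToCrosscut` for the lowered window, then `windowFrame`), the Dobrushin domain `E` cut out of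
`J` by them (`superDomainOfCrosscuts` at radius `ρw`) with `E.pt i = g i`, exact upper half-discs of
radius `ρw` at the gates, `frontier E ⊆ L 0 ∪ L 1 ∪ ∂J`, every point joined to the bulk off the cuts
inside `E`, and the closed gate rectangles inside `Eᶜ` (clauses (hE), (hB) of STAGE 2 with
`ρc := ρ'`, `ρc' := h`).
-/

noncomputable section
open scoped Topology
open Filter Set Metric
open Literature.Probability.RandomPlanarGeometry
open Literature.Topology.PlaneTopology

namespace Summit.CriticalPhenomena.SAWScalingLimit.Theorems.ObservableToSLE.TypeLadder

open Summit.CriticalPhenomena.SAWScalingLimit.Theorems.ObservableToSLER.Squeeze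
  (stub_carvedReduction_legsToCrosscut stub_carvedReduction_superDomainOfCrosscuts)

/-- **Registered carrier `stub_carvedReduction_superFrame`** (crux item stmt-CriticalPhenomena-10472,
stub T-A′ `stub_carvedReduction_squeezeGeometry_domains`, piece THE FRAMED SUPER-DOMAIN); see the
module docstring.  Radii: `0 < ρw < ρ'` (flatness radius, frame half-width), `0 < h` (frame depth
= depth of the lowered window centre). -/
theorem stub_carvedReduction_superFrame :
    ∀ (J : JordanDomain) (g : Fin 2 → ℂ) (ρ' h ρw : ℝ) (O η : Fin 2 → Set ℂ) (x : Fin 2 → Fin 2 → ℂ),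
      0 < ρw → ρw < ρ' → 0 < h →
      (∀ i, {z : ℂ | |z.re - (g i).re| ≤ ρ' ∧ (g i).im - h ≤ z.im ∧ z.im ≤ (g i).im} ⊆ J.carrier) →
      (∀ i, closedBall (g i) ρw ⊆ J.carrier) →
      (∀ i, closedBall (g i - h * Complex.I) ρ' ⊆ J.carrier) →
      (∀ i, IsOpen (O i)) → (∀ i, IsConnected (O i)) → (∀ i, O i ⊆ J.carrier) →
      (∀ i, Disjoint (O i) {z : ℂ | |z.re - (g i).re| ≤ ρ' ∧ (g i).im - h ≤ z.im ∧ z.im ≤ (g i).im}) →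
      (∀ i, Disjoint (O i) (closedBall (g i) ρw)) →
      (∀ i, Disjoint (O i) (closedBall (g i - h * Complex.I) ρ')) →
      (∀ i, segment ℝ (g i - h * Complex.I - ρ')
          (g i - h * Complex.I - ρ' - ((ρ' / 2 : ℝ) : ℂ) * Complex.I) \ {g i - h * Complex.I - ρ'} ⊆ O i) →
      (∀ i, segment ℝ (g i - h * Complex.I + ρ')
          (g i - h * Complex.I + ρ' - ((ρ' / 2 : ℝ) : ℂ) * Complex.I) \ {g i - h * Complex.I + ρ'} ⊆ O i) →
      (∀ i, J.IsCrosscut (η i) (x i 0) (x i 1)) → (∀ i, η i \ {x i 0, x i 1} ⊆ O i) →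
      (∀ i, Disjoint (η i) (segment ℝ (g i - h * Complex.I - ρ')
          (g i - h * Complex.I - ρ' - ((ρ' / 2 : ℝ) : ℂ) * Complex.I))) →
      (∀ i, Disjoint (η i) (segment ℝ (g i - h * Complex.I + ρ')
          (g i - h * Complex.I + ρ' - ((ρ' / 2 : ℝ) : ℂ) * Complex.I))) →
      Disjoint (O 0 ∪ {z : ℂ | |z.re - (g 0).re| ≤ ρ' ∧ (g 0).im - h ≤ z.im ∧ z.im ≤ (g 0).im} ∪ {x 0 0, x 0 1})
        (O 1 ∪ {z : ℂ | |z.re - (g 1).re| ≤ ρ' ∧ (g 1).im - h ≤ z.im ∧ z.im ≤ (g 1).im} ∪ {x 1 0, x 1 1}) →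
      (∀ i j, i ≠ j → Disjoint (O i ∪ {z : ℂ | |z.re - (g i).re| ≤ ρ' ∧ (g i).im - h ≤ z.im ∧ z.im ≤ (g i).im} ∪
          {x i 0, x i 1}) (closedBall (g j) ρw)) →
      JoinedIn (J.carrier \ (O 0 ∪ O 1 ∪ {z : ℂ | |z.re - (g 0).re| ≤ ρ' ∧ (g 0).im - h ≤ z.im ∧ z.im ≤ (g 0).im} ∪
          {z : ℂ | |z.re - (g 1).re| ≤ ρ' ∧ (g 1).im - h ≤ z.im ∧ z.im ≤ (g 1).im}))
        (g 0 + ((ρw / 2 : ℝ) : ℂ) * Complex.I) (g 1 + ((ρw / 2 : ℝ) : ℂ) * Complex.I) →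
      ∃ (E : DobrushinDomain) (L : Fin 2 → Set ℂ), E.pt 0 = g 0 ∧ E.pt 1 = g 1 ∧
        (∀ i, J.IsCrosscut (L i) (x i 0) (x i 1)) ∧
        (∀ i, segment ℝ (g i - ρ' - h * Complex.I) (g i - ρ') ∪ segment ℝ (g i - ρ') (g i + ρ') ∪
            segment ℝ (g i + ρ') (g i + ρ' - h * Complex.I) ⊆ L i) ∧
        (∀ i, L i ⊆ O i ∪ (segment ℝ (g i - ρ' - h * Complex.I) (g i - ρ') ∪ segment ℝ (g i - ρ') (g i + ρ') ∪
            segment ℝ (g i + ρ') (g i + ρ' - h * Complex.I)) ∪ {x i 0, x i 1}) ∧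
        (∀ i, L i ∩ {z : ℂ | |z.re - (g i).re| ≤ ρ' ∧ (g i).im - h ≤ z.im ∧ z.im ≤ (g i).im} =
          segment ℝ (g i - ρ' - h * Complex.I) (g i - ρ') ∪ segment ℝ (g i - ρ') (g i + ρ') ∪
            segment ℝ (g i + ρ') (g i + ρ' - h * Complex.I)) ∧
        (∀ i, L i ∩ closedBall (g i) ρw = segment ℝ (g i - ρw) (g i + ρw)) ∧
        E.carrier ⊆ J.carrier \ (L 0 ∪ L 1) ∧
        (∀ z : ℂ, JoinedIn (J.carrier \ (L 0 ∪ L 1)) z (g 0 + ((ρw / 2 : ℝ) : ℂ) * Complex.I) →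
          z ∈ E.carrier) ∧
        (∀ i, E.carrier ∩ ball (g i) ρw = {z : ℂ | (g i).im < z.im} ∩ ball (g i) ρw) ∧
        frontier E.carrier ⊆ L 0 ∪ L 1 ∪ frontier J.carrier ∧
        (∀ i (z : ℂ), |z.re - (g i).re| ≤ ρ' → (g i).im - h ≤ z.im → z.im ≤ (g i).im → z ∉ E.carrier) := by
  intro J g ρ' h ρw O η x hρw hρ' hh hRJ hBJ hWJ hOo hOc hOJ hOR hOB hOW hdockL hdockR hη hηO hηdL hηdR
    hsep hsepB hlink
  have hρ'0 : 0 < ρ' := hρw.trans hρ'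
  -- notation
  set R : Fin 2 → Set ℂ := fun i =>
    {z : ℂ | |z.re - (g i).re| ≤ ρ' ∧ (g i).im - h ≤ z.im ∧ z.im ≤ (g i).im} with hRdef
  set F : Fin 2 → Set ℂ := fun i =>
    segment ℝ (g i - ρ' - h * Complex.I) (g i - ρ') ∪ segment ℝ (g i - ρ') (g i + ρ') ∪
      segment ℝ (g i + ρ') (g i + ρ' - h * Complex.I) with hFdef
  have hFR : ∀ i, F i ⊆ R i := fun i => frame_subset_rect hρ'0 hh
  have hxJ : ∀ i k, x i k ∉ J.carrier := by
    intro i k hk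
    obtain ⟨-, hx0, hx1, -, -⟩ := hη i
    have hfr : x i k ∈ frontier J.carrier := by fin_cases k <;> assumption
    rw [J.isOpen.frontier_eq] at hfr
    exact hfr.2 hk
  -- Step 1: the window cross-cuts through the frames
  have key : ∀ i, ∃ L : Set ℂ, J.IsCrosscut L (x i 0) (x i 1) ∧ F i ⊆ L ∧
      L ⊆ O i ∪ F i ∪ {x i 0, x i 1} ∧ L ∩ R i = F i ∧
      L ∩ closedBall (g i) ρw = segment ℝ (g i - ρw) (g i + ρw) := by
    intro i
    obtain ⟨L', hL'c, hdiam, hL'O, -⟩ := stub_carvedReduction_legsToCrosscut J (g i - h * Complex.I) ρ'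
      (O i) (η i) (x i) hρ'0 (hWJ i) (hOo i) (hOc i) (hOJ i) (hOW i) (hdockL i) (hdockR i) (hη i) (hηO i)
      (hηdL i) (hηdR i)
    have e1 : g i - ↑h * Complex.I - ↑ρ' = g i - ↑ρ' - ↑h * Complex.I := by ring
    have e2 : g i - ↑h * Complex.I + ↑ρ' = g i + ↑ρ' - ↑h * Complex.I := by ring
    rw [e1, e2] at hdiam hL'O
    exact stub_carvedReduction_windowFrame J (g i) ρ' h ρw (O i) L' (x i) hρw hρ' hh (hRJ i) (hBJ i)
      (hOR i) (hOB i) hL'c hdiam hL'O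
  choose L hLc hFL hLO hLR hLB using key
  have hLsub : ∀ i, L i ⊆ O i ∪ R i ∪ {x i 0, x i 1} := fun i z hz => by
    rcases hLO i hz with (h1 | h1) | h1
    · exact Or.inl (Or.inl h1)
    · exact Or.inl (Or.inr (hFR i h1))
    · exact Or.inr h1
  -- Step 2: the cutting
  have hdisj : Disjoint (L 0) (L 1) :=
    Set.disjoint_of_subset (hLsub 0) (hLsub 1) hsep
  have hfar : ∀ i j, i ≠ j → Disjoint (L i) (closedBall (g j) ρw) := fun i j hij =>
    Set.disjoint_of_subset_left (hLsub i) (hsepB i j hij)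
  have hJL : J.carrier \ (O 0 ∪ O 1 ∪ R 0 ∪ R 1) ⊆ J.carrier \ (L 0 ∪ L 1) := by
    rintro z ⟨hzJ, hz⟩
    refine ⟨hzJ, ?_⟩
    rintro (hzL | hzL)
    · rcases hLsub 0 hzL with (h1 | h1) | h1
      · exact hz (Or.inl (Or.inl (Or.inl h1)))
      · exact hz (Or.inl (Or.inr h1))
      · rcases h1 with h1 | h1 <;> exact hxJ 0 _ (h1 ▸ hzJ)
    · rcases hLsub 1 hzL with (h1 | h1) | h1
      · exact hz (Or.inl (Or.inl (Or.inr h1)))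
      · exact hz (Or.inr h1)
      · rcases h1 with h1 | h1 <;> exact hxJ 1 _ (h1 ▸ hzJ)
  obtain ⟨E, hE0, hE1, hEJ, hjoin, hflat, hfront⟩ := stub_carvedReduction_superDomainOfCrosscuts J g ρw L x
    hρw hBJ hLc hdisj hLB (hfar 0 1 (by decide)) (hfar 1 0 (by decide)) (hlink.mono hJL)
  refine ⟨E, L, hE0, hE1, hLc, hFL, hLO, hLR, hLB, hEJ, hjoin, hflat, hfront, fun i => ?_⟩
  -- Step 3: the boxes
  have hCR : (L 0 ∪ L 1) ∩ R i ⊆ F i := by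
    rintro z ⟨hzL, hzR⟩
    have hself : z ∈ L i → z ∈ F i := fun h1 => by rw [← hLR i]; exact ⟨h1, hzR⟩
    have hother : ∀ j, j ≠ i → z ∉ L j := by
      intro j hji hzj
      have h1 := hLsub j hzj
      fin_cases i <;> fin_cases j
      · exact absurd rfl hji
      · exact Set.disjoint_left.1 hsep (Or.inl (Or.inr hzR)) h1
      · exact Set.disjoint_left.1 hsep h1 (Or.inl (Or.inr hzR))
      · exact absurd rfl hji
    rcases hzL with hzL | hzL
    · by_cases h0 : (0 : Fin 2) = i
      · exact hself (h0 ▸ hzL)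
      · exact absurd hzL (hother 0 h0)
    · by_cases h1 : (1 : Fin 2) = i
      · exact hself (h1 ▸ hzL)
      · exact absurd hzL (hother 1 h1)
  have hFC : F i ⊆ L 0 ∪ L 1 := by
    fin_cases i
    · exact (hFL 0).trans subset_union_left
    · exact (hFL 1).trans subset_union_right
  exact superDomain_box_subset_compl (J := J) hρw hρ'0 hh E.isOpen hEJ hfront (hflat i) (hRJ i) hFC hCR

end Summit.CriticalPhenomena.SAWScalingLimit.Theorems.ObservableToSLE.TypeLadder

end
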